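import Literature.NumberTheory.Transcendental.CurvePeriodsEllipticLiftInvarianceProofs
import Literature.NumberTheory.Transcendental.CurvePeriodsEllipticTranslationProofs
import HarnessLib

/-!
# Periods of curve type on an elliptic curve, IX: the calculus of lifted symbols

Companion of `Literature/NumberTheory/Transcendental/CurvePeriods.lean` (Huber–Wüstholz 2022,
Thm. 13.3 (2), rendered on explicit period symbols `(Z, ω, γ)` with the elementary relations
(R1)–(R5)) and of `CurvePeriodsEllipticLiftInvarianceProofs.lean` (the symbol `(E_L, ω, φ∘g)` of a
lifted path depends only on `g(0), g(1) ∈ ℂ ∖ Λ`) and `CurvePeriodsEllipticTranslationProofs.lean`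
(translation by an algebraic point is functoriality). Here the resulting CALCULUS of lifted
symbols `Sym(z₀ ↝ z₁)` is set up, for arbitrary `C¹` lifts and without any lattice-avoidance
hypotheses beyond the end points:

* `Ell.finite_lattice_inter_closedBall`, `Ell.finite_translates_inter_closedBall` — finitely many
  points of `Λ` (of finitely many translates `c + Λ`) in a ball (`ProperSpace`/`DiscreteTopology`
  of `L.lattice`);
* `Ell.exists_corner`, `Ell.exists_path_avoiding`, `Ell.exists_path_avoiding_translates` — between
  two points off a locally finite set `S ⊂ ℂ` there is a smooth one-corner polygon
  (`Ell.polygon`) avoiding `S` (all but finitely many corners `a + (b − a)(½ + εi)` work); in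
  particular `C¹` lifts `z₀ ↝ z₁` avoiding `Λ` and finitely many translates `±v + Λ` exist;
* `Ell.span_lift_add` — **additivity** `Sym(z₀ ↝ z₂) ∼ Sym(z₀ ↝ z₁) + Sym(z₁ ↝ z₂)` for ANY lifts
  (a two-corner polygon through `z₁` split by (R5), `isElementaryRelation_split`, and lift
  invariance); `Ell.span_lift_self` — `Sym(z₀ ↝ z₀) ∼ 0`; `Ell.span_lift_add_lift_rev` —
  `Sym(z₀ ↝ z₁) + Sym(z₁ ↝ z₀) ∼ 0`; `Ell.liftPath_add_of_mem` — `φ∘(g + l) = φ∘g` for `l ∈ Λ`;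
* `Ell.span_lift_translate_theta0`, `Ell.span_lift_translate_theta1` — **translation invariance
  for arbitrary lifts**: for an algebraic point `P = φ(v)` and `z₀, z₁ ∉ ±v + Λ`,
  `Sym_{θ₀}(z₀ + v ↝ z₁ + v) ∼ Sym_{θ₀}(z₀ ↝ z₁)` and the same for `θ₁` up to the algebraic
  constant `R(ψ_v(z₁)) − R(ψ_v(z₀))` (re-route the lift around `Λ ∪ (±v + Λ)`, translate by
  `Ell.span_translate_theta0/1`, compare by lift invariance).

These are the relations of `H₁(E^an, D; ℤ)` together with the group law, as needed for the
open-path case of Theorem 13.3 (2) on `E_L`.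

## References

* A. Huber, G. Wüstholz, *Transcendence and Linear Relations of 1-Periods*, Cambridge Tracts in
  Mathematics 227, CUP 2022 [HuberWustholz2022]: §3.3.1 (pp. 42–44), §13.1 (B) (p. 120),
  §18.1 (p. 160), Thm. 13.3 (2) (p. 121).
-/

noncomputable section

open scoped BigOperators
open scoped PeriodPair
open scoped Topology
open MvPolynomial Set Complex Filter Metric

namespace Literature.NumberTheory.Transcendental

namespace CurvePeriods

set_option quotPrecheck false in
/-- Membership in the `ℚ̄`-span of the elementary relations, in the format of the conclusion of
`HuberWustholzCurvePeriods`. -/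
local notation "InSpan" c:max => ∃ (k : ℕ) (ρ : Fin k → (PeriodSymbol →₀ ℂ)) (a : Fin k → ℂ),
  (∀ l, IsElementaryRelation (ρ l)) ∧ (∀ l, IsAlgebraic ℚ (a l)) ∧ c = ∑ l, a l • ρ l

namespace Ell

variable (L : PeriodPair)

/-! ### Locally finite obstacle sets: lattice translates -/

/-- **Lattice points in a ball are finite.** [folklore] -/
theorem finite_lattice_inter_closedBall (p : ℂ) (R : ℝ) :
    ((L.lattice : Set ℂ) ∩ closedBall p R).Finite := by
  have hfin : (closedBall (0 : L.lattice) (R + ‖p‖)).Finite :=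
    isCompact_iff_finite.mp (isCompact_closedBall (0 : L.lattice) (R + ‖p‖))
  refine (hfin.image Subtype.val).subset ?_
  rintro z ⟨hz, hzb⟩
  refine ⟨⟨z, hz⟩, ?_, rfl⟩
  rw [mem_closedBall, dist_zero_right]
  rw [mem_closedBall, dist_eq_norm] at hzb
  calc ‖(⟨z, hz⟩ : L.lattice)‖ = ‖z‖ := rfl
    _ = ‖(z - p) + p‖ := by rw [sub_add_cancel]
    _ ≤ ‖z - p‖ + ‖p‖ := norm_add_le _ _
    _ ≤ R + ‖p‖ := by linarith

/-- **The union of finitely many lattice translates `c + Λ` is locally finite.** [folklore] -/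
theorem finite_translates_inter_closedBall (C : Finset ℂ) (p : ℂ) (R : ℝ) :
    ({z : ℂ | ∃ c ∈ C, z - c ∈ L.lattice} ∩ closedBall p R).Finite := by
  have h : {z : ℂ | ∃ c ∈ C, z - c ∈ L.lattice} ∩ closedBall p R ⊆
      ⋃ c ∈ C, (fun l => l + c) '' ((L.lattice : Set ℂ) ∩ closedBall (p - c) R) := by
    rintro z ⟨⟨c, hc, hz⟩, hzb⟩
    refine mem_iUnion₂.2 ⟨c, hc, z - c, ⟨hz, ?_⟩, sub_add_cancel z c⟩
    rw [mem_closedBall, dist_eq_norm] at hzb ⊢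
    have e : z - c - (p - c) = z - p := by ring
    rwa [e]
  exact (C.finite_toSet.biUnion fun c _ =>
    (finite_lattice_inter_closedBall L (p - c) R).image _).subset h

/-! ### Segments and corners avoiding a locally finite set -/

/-- Real and imaginary parts of `θ/2 + θε i` and of `(1+θ)/2 + ε(1−θ) i`. [folklore] -/
theorem re_im_aux (x y : ℝ) : (((x : ℂ) + (y : ℂ) * I).re = x) ∧ (((x : ℂ) + (y : ℂ) * I).im = y) := by
  constructor <;> simp

/-- **A corner avoiding a locally finite set.** If `S ⊂ ℂ` meets every closed ball in a finite
set and `a, b ∉ S`, there is a point `q` such that the two closed segments `[a, q]`, `[q, b]`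
avoid `S` (all but finitely many offsets `q = a + (b − a)(½ + εi)` work). [folklore] -/
theorem exists_corner {S : Set ℂ} (hfin : ∀ (p : ℂ) (R : ℝ), (S ∩ closedBall p R).Finite) {a b : ℂ}
    (ha : a ∉ S) (hb : b ∉ S) :
    ∃ q : ℂ, (∀ θ ∈ Icc (0 : ℝ) 1, a + (θ : ℂ) * (q - a) ∉ S) ∧
      (∀ θ ∈ Icc (0 : ℝ) 1, q + (θ : ℂ) * (b - q) ∉ S) := by
  by_cases hab : a = b
  · subst hab
    refine ⟨a, fun θ _ => by simpa using ha, fun θ _ => by simpa using ha⟩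
  set d : ℂ := b - a with hd
  have hd0 : d ≠ 0 := sub_ne_zero.2 (Ne.symm hab)
  set F : Set ℂ := S ∩ closedBall a (2 * ‖d‖) with hF
  have hFfin : F.Finite := hfin a (2 * ‖d‖)
  -- the excluded offsets
  set bad₁ : ℂ → ℝ := fun p => ((p - a) / d).im / (2 * ((p - a) / d).re) with hbad₁
  set bad₂ : ℂ → ℝ := fun p => ((p - a) / d).im / (2 * (1 - ((p - a) / d).re)) with hbad₂
  obtain ⟨ε, ⟨hε0, hε1⟩, hεbad⟩ : ∃ ε ∈ Ioo (0 : ℝ) 1, ε ∉ bad₁ '' F ∪ bad₂ '' F :=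
    ((Ioo_infinite zero_lt_one).sdiff ((hFfin.image bad₁).union (hFfin.image bad₂))).nonempty
  refine ⟨a + d * ((1 / 2 : ℂ) + (ε : ℂ) * I), fun θ hθ hS => ?_, fun θ hθ hS => ?_⟩
  · -- `[a, q]`: the point is `a + θ d (1/2 + ε i)`
    have hP : a + (θ : ℂ) * (a + d * ((1 / 2 : ℂ) + (ε : ℂ) * I) - a) =
        a + d * (((θ / 2 : ℝ) : ℂ) + ((θ * ε : ℝ) : ℂ) * I) := by push_cast; ring
    rw [hP] at hS
    rcases hθ.1.lt_or_eq with hθ0 | hθ0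
    · have hmem : a + d * (((θ / 2 : ℝ) : ℂ) + ((θ * ε : ℝ) : ℂ) * I) ∈ F := by
        refine ⟨hS, ?_⟩
        rw [mem_closedBall, dist_eq_norm, add_sub_cancel_left, norm_mul]
        have hn : ‖((θ / 2 : ℝ) : ℂ) + ((θ * ε : ℝ) : ℂ) * I‖ ≤ 2 := by
          have hn1 : ‖((θ / 2 : ℝ) : ℂ)‖ ≤ 1 := by
            rw [Complex.norm_real, Real.norm_eq_abs, abs_of_nonneg (by linarith [hθ.1])]
            linarith [hθ.2]
          have hn2 : ‖((θ * ε : ℝ) : ℂ) * I‖ ≤ 1 := by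
            rw [norm_mul, Complex.norm_I, mul_one, Complex.norm_real, Real.norm_eq_abs,
              abs_of_nonneg (by nlinarith [hθ.1, hε0.le])]
            nlinarith [hθ.1, hθ.2, hε0.le, hε1.le]
          exact (norm_add_le _ _).trans (by linarith)
        calc ‖d‖ * ‖((θ / 2 : ℝ) : ℂ) + ((θ * ε : ℝ) : ℂ) * I‖ ≤ ‖d‖ * 2 :=
              mul_le_mul_of_nonneg_left hn (norm_nonneg _)
          _ = 2 * ‖d‖ := by ring
      apply hεbad
      refine Or.inl ⟨_, hmem, ?_⟩
      rw [hbad₁]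
      simp only [add_sub_cancel_left, mul_div_cancel_left₀ _ hd0]
      rw [(re_im_aux _ _).1, (re_im_aux _ _).2, show 2 * (θ / 2) = θ by ring, mul_comm θ ε,
        mul_div_assoc, div_self hθ0.ne', mul_one]
    · subst hθ0
      apply ha
      simpa using hS
  · -- `[q, b]`: the point is `a + d ((1+θ)/2 + ε(1−θ) i)`
    have hP : a + d * ((1 / 2 : ℂ) + (ε : ℂ) * I) +
        (θ : ℂ) * (b - (a + d * ((1 / 2 : ℂ) + (ε : ℂ) * I))) =
        a + d * ((((1 + θ) / 2 : ℝ) : ℂ) + ((ε * (1 - θ) : ℝ) : ℂ) * I) := by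
      rw [hd]; push_cast; ring
    rw [hP] at hS
    rcases hθ.2.lt_or_eq with hθ1 | hθ1
    · have hmem : a + d * ((((1 + θ) / 2 : ℝ) : ℂ) + ((ε * (1 - θ) : ℝ) : ℂ) * I) ∈ F := by
        refine ⟨hS, ?_⟩
        rw [mem_closedBall, dist_eq_norm, add_sub_cancel_left, norm_mul]
        have hn : ‖(((1 + θ) / 2 : ℝ) : ℂ) + ((ε * (1 - θ) : ℝ) : ℂ) * I‖ ≤ 2 := by
          have hn1 : ‖(((1 + θ) / 2 : ℝ) : ℂ)‖ ≤ 1 := by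
            rw [Complex.norm_real, Real.norm_eq_abs, abs_of_nonneg (by linarith [hθ.1])]
            linarith [hθ.2]
          have hn2 : ‖((ε * (1 - θ) : ℝ) : ℂ) * I‖ ≤ 1 := by
            rw [norm_mul, Complex.norm_I, mul_one, Complex.norm_real, Real.norm_eq_abs,
              abs_of_nonneg (by nlinarith [hθ.2, hε0.le])]
            nlinarith [hθ.1, hθ.2, hε0.le, hε1.le]
          exact (norm_add_le _ _).trans (by linarith)
        calc ‖d‖ * ‖(((1 + θ) / 2 : ℝ) : ℂ) + ((ε * (1 - θ) : ℝ) : ℂ) * I‖ ≤ ‖d‖ * 2 :=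
              mul_le_mul_of_nonneg_left hn (norm_nonneg _)
          _ = 2 * ‖d‖ := by ring
      apply hεbad
      refine Or.inr ⟨_, hmem, ?_⟩
      rw [hbad₂]
      simp only [add_sub_cancel_left, mul_div_cancel_left₀ _ hd0]
      have h1 : (1 : ℝ) - θ ≠ 0 := by linarith
      rw [(re_im_aux _ _).1, (re_im_aux _ _).2, show 2 * (1 - (1 + θ) / 2) = 1 - θ by ring,
        mul_div_assoc, div_self h1, mul_one]
    · subst hθ1
      have e : a + d * ((((1 + 1) / 2 : ℝ) : ℂ) + ((ε * (1 - 1) : ℝ) : ℂ) * I) = b := by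
        rw [hd]; push_cast; ring
      rw [e] at hS
      exact hb hS

/-- **`C¹` paths avoiding a locally finite set.** If `S ⊂ ℂ` meets every closed ball in a
finite set and `a, b ∉ S`, there is a `C¹` map `g : ℝ → ℂ` with `g(0) = a`, `g(1) = b` and
`g([0,1]) ∩ S = ∅` (a smooth one-corner polygon, `Ell.polygon`). [folklore] -/
theorem exists_path_avoiding {S : Set ℂ} (hfin : ∀ (p : ℂ) (R : ℝ), (S ∩ closedBall p R).Finite)
    {a b : ℂ} (ha : a ∉ S) (hb : b ∉ S) :
    ∃ g : ℝ → ℂ, ContDiff ℝ 1 g ∧ g 0 = a ∧ g 1 = b ∧ ∀ t ∈ Icc (0 : ℝ) 1, g t ∉ S := by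
  obtain ⟨q, h₁, h₂⟩ := exists_corner hfin ha hb
  set w : ℕ → ℂ := fun i => if i = 0 then a else if i = 1 then q else b with hw
  refine ⟨polygon w 2, contDiff_polygon w 2, ?_, ?_, fun t ht => ?_⟩
  · have h := polygon_vertex w (N := 2) (i := 0) two_pos (Nat.zero_le 2)
    simp only [Nat.cast_zero, Nat.cast_ofNat, zero_div] at h
    rw [h, hw]
    simp
  · rw [polygon_of_one_le w 2 le_rfl, hw]
    simp
  · obtain ⟨i, hi, s, hs, rfl⟩ := exists_slot_of_mem_Icc (N := 2) two_pos ht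
    have hslot := polygon_slot w hi hs
    rw [hslot]
    obtain ⟨θ, hθ, hθe⟩ := smoothSeg_mem (w i) (w (i + 1)) s
    rw [hθe]
    interval_cases i
    · simpa [hw] using h₁ θ hθ
    · simpa [hw] using h₂ θ hθ

/-- **Lifts between points off finitely many lattice translates.** For `a, b ∈ ℂ` avoiding the
translates `c + Λ`, `c ∈ C` (finite), there is a `C¹` path from `a` to `b` in `ℂ` whose values on
`[0,1]` avoid all of them. [folklore] -/
theorem exists_path_avoiding_translates (C : Finset ℂ) {a b : ℂ}
    (ha : ∀ c ∈ C, a - c ∉ L.lattice) (hb : ∀ c ∈ C, b - c ∉ L.lattice) :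
    ∃ g : ℝ → ℂ, ContDiff ℝ 1 g ∧ g 0 = a ∧ g 1 = b ∧
      ∀ t ∈ Icc (0 : ℝ) 1, ∀ c ∈ C, g t - c ∉ L.lattice := by
  obtain ⟨g, hg, h0, h1, hS⟩ := exists_path_avoiding (S := {z : ℂ | ∃ c ∈ C, z - c ∈ L.lattice})
    (finite_translates_inter_closedBall L C) (a := a) (b := b)
    (fun ⟨c, hc, h⟩ => ha c hc h) (fun ⟨c, hc, h⟩ => hb c hc h)
  exact ⟨g, hg, h0, h1, fun t ht c hc h => hS t ht ⟨c, hc, h⟩⟩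

/-! ### The calculus of lifted symbols -/

section Calculus

variable (h₂ : IsAlgebraic ℚ L.g₂) (h₃ : IsAlgebraic ℚ L.g₃)
include h₂ h₃

/-- **Additivity of lifted symbols.** For `C¹` lifts `g₀₂ : z₀ ↝ z₂`, `g₀₁ : z₀ ↝ z₁`,
`g₁₂ : z₁ ↝ z₂` in `ℂ ∖ Λ` (algebraic end points),
`(E_L, ω, φ∘g₀₂) − (E_L, ω, φ∘g₀₁) − (E_L, ω, φ∘g₁₂)` lies in the span of the elementary
relations: a smooth two-corner polygon `z₀ → z₁ → z₂` avoiding `Λ` (`exists_corner`) splits at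
`z₁` by (R5) (`isElementaryRelation_split`), and lift invariance (`span_liftPath_sub_liftPath`)
compares its pieces with the given lifts. [cite: HuberWustholz2022, §3.3.1 (pp. 42–44)] -/
theorem span_lift_add {g₀₂ g₀₁ g₁₂ : ℝ → ℂ} (hg₀₂ : ContDiff ℝ 1 g₀₂) (hg₀₁ : ContDiff ℝ 1 g₀₁)
    (hg₁₂ : ContDiff ℝ 1 g₁₂)
    (hΛ₀₂ : ∀ t ∈ Icc (0 : ℝ) 1, g₀₂ t ∉ L.lattice) (hΛ₀₁ : ∀ t ∈ Icc (0 : ℝ) 1, g₀₁ t ∉ L.lattice)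
    (hΛ₁₂ : ∀ t ∈ Icc (0 : ℝ) 1, g₁₂ t ∉ L.lattice)
    (a₀₂ : IsAlgPt L (g₀₂ 0)) (b₀₂ : IsAlgPt L (g₀₂ 1)) (a₀₁ : IsAlgPt L (g₀₁ 0))
    (b₀₁ : IsAlgPt L (g₀₁ 1)) (a₁₂ : IsAlgPt L (g₁₂ 0)) (b₁₂ : IsAlgPt L (g₁₂ 1))
    (e₀ : g₀₁ 0 = g₀₂ 0) (e₁ : g₁₂ 0 = g₀₁ 1) (e₂ : g₁₂ 1 = g₀₂ 1)
    (ω : Fin 2 → MvPolynomial (Fin 2) ℂ) (hω : ∀ k, HasAlgCoeffs (ω k)) :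
    InSpan (Finsupp.single (⟨curve L, smooth L h₂ h₃, ω, hω, liftPath L g₀₂ hg₀₂ hΛ₀₂ a₀₂ b₀₂⟩ :
        PeriodSymbol) (1 : ℂ) -
      Finsupp.single (⟨curve L, smooth L h₂ h₃, ω, hω, liftPath L g₀₁ hg₀₁ hΛ₀₁ a₀₁ b₀₁⟩ :
        PeriodSymbol) 1 -
      Finsupp.single (⟨curve L, smooth L h₂ h₃, ω, hω, liftPath L g₁₂ hg₁₂ hΛ₁₂ a₁₂ b₁₂⟩ :
        PeriodSymbol) 1) := by
  have hE := smooth L h₂ h₃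
  have hfin : ∀ (p : ℂ) (R : ℝ), ((L.lattice : Set ℂ) ∩ closedBall p R).Finite :=
    finite_lattice_inter_closedBall L
  -- the two corners
  obtain ⟨q₁, hq₁, hq₁'⟩ := exists_corner hfin (a := g₀₂ 0) (b := g₀₁ 1) a₀₂.1 b₀₁.1
  obtain ⟨q₂, hq₂, hq₂'⟩ := exists_corner hfin (a := g₀₁ 1) (b := g₀₂ 1) b₀₁.1 b₀₂.1
  set w : ℕ → ℂ := fun i => if i = 0 then g₀₂ 0 else if i = 1 then q₁ else if i = 2 then g₀₁ 1
    else if i = 3 then q₂ else g₀₂ 1 with hw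
  set h : ℝ → ℂ := polygon w 4 with hh
  have hhC : ContDiff ℝ 1 h := contDiff_polygon w 4
  have hh0 : h 0 = g₀₂ 0 := by
    have h' := polygon_vertex w (N := 4) (i := 0) (by norm_num) (Nat.zero_le 4)
    simp only [Nat.cast_zero, Nat.cast_ofNat, zero_div] at h'
    rw [hh, h', hw]
    simp
  have hhhalf : h (1 / 2) = g₀₁ 1 := by
    have h' := polygon_vertex w (N := 4) (i := 2) (by norm_num) (by norm_num)
    have e : ((2 : ℕ) : ℝ) / ((4 : ℕ) : ℝ) = 1 / 2 := by norm_num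
    rw [e] at h'
    rw [hh, h', hw]
    simp
  have hh1 : h 1 = g₀₂ 1 := by
    rw [hh, polygon_of_one_le w 4 le_rfl, hw]
    simp
  have hhΛ : ∀ u ∈ Icc (0 : ℝ) 1, h u ∉ L.lattice := by
    intro u hu
    obtain ⟨i, hi, s, hs, rfl⟩ := exists_slot_of_mem_Icc (N := 4) (by norm_num) hu
    have hslot := polygon_slot w hi hs
    rw [hh, hslot]
    obtain ⟨θ, hθ, hθe⟩ := smoothSeg_mem (w i) (w (i + 1)) s
    rw [hθe]
    interval_cases i
    · simpa [hw] using hq₁ θ hθ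
    · simpa [hw] using hq₁' θ hθ
    · simpa [hw] using hq₂ θ hθ
    · simpa [hw] using hq₂' θ hθ
  -- the halves
  have hIcc₁ : ∀ t ∈ Icc (0 : ℝ) 1, 1 / 2 * t ∈ Icc (0 : ℝ) 1 := fun t ht =>
    ⟨by nlinarith [ht.1], by nlinarith [ht.2]⟩
  have hIcc₂ : ∀ t ∈ Icc (0 : ℝ) 1, 1 / 2 + (1 - 1 / 2) * t ∈ Icc (0 : ℝ) 1 := fun t ht =>
    ⟨by nlinarith [ht.1], by nlinarith [ht.2]⟩
  have hC₁ : ContDiff ℝ 1 fun t : ℝ => h (1 / 2 * t) := hhC.comp (contDiff_const.mul contDiff_id)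
  have hC₂ : ContDiff ℝ 1 fun t : ℝ => h (1 / 2 + (1 - 1 / 2) * t) :=
    hhC.comp (contDiff_const.add (contDiff_const.mul contDiff_id))
  have hΛ₁ : ∀ t ∈ Icc (0 : ℝ) 1, h (1 / 2 * t) ∉ L.lattice := fun t ht => hhΛ _ (hIcc₁ t ht)
  have hΛ₂ : ∀ t ∈ Icc (0 : ℝ) 1, h (1 / 2 + (1 - 1 / 2) * t) ∉ L.lattice := fun t ht =>
    hhΛ _ (hIcc₂ t ht)
  have ha₁ : IsAlgPt L ((fun t : ℝ => h (1 / 2 * t)) 0) := by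
    simp only [mul_zero]; rw [hh0]; exact a₀₂
  have hb₁ : IsAlgPt L ((fun t : ℝ => h (1 / 2 * t)) 1) := by
    simp only [mul_one]; rw [hhhalf]; exact b₀₁
  have ha₂ : IsAlgPt L ((fun t : ℝ => h (1 / 2 + (1 - 1 / 2) * t)) 0) := by
    simp only [mul_zero, add_zero]; rw [hhhalf]; exact b₀₁
  have hb₂ : IsAlgPt L ((fun t : ℝ => h (1 / 2 + (1 - 1 / 2) * t)) 1) := by
    have e : (1 / 2 : ℝ) + (1 - 1 / 2) * 1 = 1 := by norm_num
    simp only [e]; rw [hh1]; exact b₀₂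
  have hPa : IsAlgPt L (h 0) := by rw [hh0]; exact a₀₂
  have hPb : IsAlgPt L (h 1) := by rw [hh1]; exact b₀₂
  set P := liftPath L h hhC hhΛ hPa hPb with hP
  set P₁ := liftPath L (fun t : ℝ => h (1 / 2 * t)) hC₁ hΛ₁ ha₁ hb₁ with hP₁
  set P₂ := liftPath L (fun t : ℝ => h (1 / 2 + (1 - 1 / 2) * t)) hC₂ hΛ₂ ha₂ hb₂ with hP₂
  have hsplit := isElementaryRelation_split hE ω hω P P₁ P₂ (τ := 1 / 2)
    ⟨by norm_num, by norm_num⟩ (fun t _ => rfl) (fun t _ => rfl)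
  -- lift invariance for the three pieces
  have r₀₂ := span_liftPath_sub_liftPath L h₂ h₃ hg₀₂ hhC hΛ₀₂ hhΛ a₀₂ b₀₂ hPa hPb hh0 hh1 ω hω
  have r₀₁ := span_liftPath_sub_liftPath L h₂ h₃ hg₀₁ hC₁ hΛ₀₁ hΛ₁ a₀₁ b₀₁ ha₁ hb₁
    (by simp only [mul_zero]; rw [hh0, e₀]) (by simp only [mul_one]; rw [hhhalf]) ω hω
  have r₁₂ := span_liftPath_sub_liftPath L h₂ h₃ hg₁₂ hC₂ hΛ₁₂ hΛ₂ a₁₂ b₁₂ ha₂ hb₂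
    (by simp only [mul_zero, add_zero]; rw [hhhalf, e₁])
    (by have e : (1 / 2 : ℝ) + (1 - 1 / 2) * 1 = 1 := by norm_num
        simp only [e]; rw [hh1, e₂]) ω hω
  obtain ⟨K, ρ, cf, hρ, hcf, hsum⟩ :=
    span_sub (span_sub (span_sub r₀₂ r₀₁) r₁₂) (span_of_rel hsplit)
  refine ⟨K, ρ, cf, hρ, hcf, ?_⟩
  rw [← hsum]
  abel

/-- **A lift with equal end points has symbol `∼ 0`** (lift invariance against the constant
lift, and `(Z, ω, const) ∼ 0`). [cite: HuberWustholz2022, §3.3.1 (p. 44)] -/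
theorem span_lift_self {g : ℝ → ℂ} (hg : ContDiff ℝ 1 g)
    (hΛ : ∀ t ∈ Icc (0 : ℝ) 1, g t ∉ L.lattice) (h0 : IsAlgPt L (g 0)) (h1 : IsAlgPt L (g 1))
    (he : g 1 = g 0) (ω : Fin 2 → MvPolynomial (Fin 2) ℂ) (hω : ∀ k, HasAlgCoeffs (ω k)) :
    InSpan (Finsupp.single (⟨curve L, smooth L h₂ h₃, ω, hω, liftPath L g hg hΛ h0 h1⟩ :
      PeriodSymbol) (1 : ℂ)) := by
  have hE := smooth L h₂ h₃
  have hc : ContDiff ℝ 1 fun _ : ℝ => g 0 := contDiff_const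
  have hcΛ : ∀ t ∈ Icc (0 : ℝ) 1, (fun _ : ℝ => g 0) t ∉ L.lattice := fun _ _ => h0.1
  have r := span_liftPath_sub_liftPath L h₂ h₃ hg hc hΛ hcΛ h0 h1 h0 (by simpa [he] using h1)
    rfl (by simp [he]) ω hω
  have rc := isElementaryRelation_single_of_const hE ω hω
    (liftPath L (fun _ : ℝ => g 0) hc hcΛ h0 (by simpa [he] using h1)) (phi L (g 0))
    (fun t _ => rfl)
  obtain ⟨K, ρ, cf, hρ, hcf, hsum⟩ := span_add r (span_of_rel rc)
  exact ⟨K, ρ, cf, hρ, hcf, by rw [← hsum]; abel⟩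

/-- **Reversal**: for lifts `g : z₀ ↝ z₁` and `g′ : z₁ ↝ z₀`, `(E_L, ω, φ∘g) + (E_L, ω, φ∘g′) ∼ 0`.
[cite: HuberWustholz2022, §3.3.1 (p. 42)] -/
theorem span_lift_add_lift_rev {g g' : ℝ → ℂ} (hg : ContDiff ℝ 1 g) (hg' : ContDiff ℝ 1 g')
    (hΛ : ∀ t ∈ Icc (0 : ℝ) 1, g t ∉ L.lattice) (hΛ' : ∀ t ∈ Icc (0 : ℝ) 1, g' t ∉ L.lattice)
    (h0 : IsAlgPt L (g 0)) (h1 : IsAlgPt L (g 1)) (h0' : IsAlgPt L (g' 0)) (h1' : IsAlgPt L (g' 1))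
    (hs : g' 0 = g 1) (he : g' 1 = g 0)
    (ω : Fin 2 → MvPolynomial (Fin 2) ℂ) (hω : ∀ k, HasAlgCoeffs (ω k)) :
    InSpan (Finsupp.single (⟨curve L, smooth L h₂ h₃, ω, hω, liftPath L g hg hΛ h0 h1⟩ :
        PeriodSymbol) (1 : ℂ) +
      Finsupp.single (⟨curve L, smooth L h₂ h₃, ω, hω, liftPath L g' hg' hΛ' h0' h1'⟩ :
        PeriodSymbol) 1) := by
  have hc : ContDiff ℝ 1 fun _ : ℝ => g 0 := contDiff_const
  have hcΛ : ∀ t ∈ Icc (0 : ℝ) 1, (fun _ : ℝ => g 0) t ∉ L.lattice := fun _ _ => h0.1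
  have radd := span_lift_add L h₂ h₃ hc hg hg' hcΛ hΛ hΛ' h0 h0 h0 h1 h0' h1' rfl hs he ω hω
  have rself := span_lift_self L h₂ h₃ hc hcΛ h0 h0 rfl ω hω
  obtain ⟨K, ρ, cf, hρ, hcf, hsum⟩ := span_sub rself radd
  exact ⟨K, ρ, cf, hρ, hcf, by rw [← hsum]; abel⟩

omit h₂ h₃ in
/-- **Lattice translation does not change the lifted path**: `φ∘(g + l) = φ∘g` for `l ∈ Λ`.
[folklore] -/
theorem liftPath_add_of_mem {g : ℝ → ℂ} {l : ℂ} (hl : l ∈ L.lattice) (hg : ContDiff ℝ 1 g)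
    (hΛ : ∀ t ∈ Icc (0 : ℝ) 1, g t ∉ L.lattice) (h0 : IsAlgPt L (g 0)) (h1 : IsAlgPt L (g 1))
    (hg' : ContDiff ℝ 1 fun t => g t + l) (hΛ' : ∀ t ∈ Icc (0 : ℝ) 1, g t + l ∉ L.lattice)
    (h0' : IsAlgPt L (g 0 + l)) (h1' : IsAlgPt L (g 1 + l)) :
    liftPath L (fun t => g t + l) hg' hΛ' h0' h1' = liftPath L g hg hΛ h0 h1 :=
  CurvePath.eq_of_toFun_eq fun t => by simp [phi_add_of_mem L _ hl]

omit h₂ h₃ in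
/-- `℘(z) ≠ ℘(v)` iff `z` avoids `±v + Λ` (`z, v ∉ Λ`). [folklore] -/
theorem weierstrassP_ne_iff {z v : ℂ} (hz : z ∉ L.lattice) (hv : v ∉ L.lattice) :
    ℘[L] z ≠ ℘[L] v ↔ z + v ∉ L.lattice ∧ z - v ∉ L.lattice := by
  rw [Ne, L.weierstrassP_eq_weierstrassP_iff hz hv, not_or]

/-- **Translation invariance for arbitrary lifts, `θ₀`.** Let `P = φ(v)` be an algebraic point,
`g : z₀ ↝ z₁` and `g′ : z₀ + v ↝ z₁ + v` `C¹` lifts in `ℂ ∖ Λ` with algebraic end points, and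
`z₀, z₁ ∉ ±v + Λ`. Then `(E_L, θ₀, φ∘g′) ∼ (E_L, θ₀, φ∘g)`: re-route `g` around `Λ ∪ (±v + Λ)`
(`exists_path_avoiding_translates`), translate (`span_translate_theta0`), and use lift
invariance twice. [cite: HuberWustholz2022, §13.1 (B) (p. 120), §18.1 (p. 160)] -/
theorem span_lift_translate_theta0 {v : ℂ} (hv : IsAlgPt L v) {g g' : ℝ → ℂ}
    (hg : ContDiff ℝ 1 g) (hg' : ContDiff ℝ 1 g')
    (hΛ : ∀ t ∈ Icc (0 : ℝ) 1, g t ∉ L.lattice) (hΛ' : ∀ t ∈ Icc (0 : ℝ) 1, g' t ∉ L.lattice)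
    (h0 : IsAlgPt L (g 0)) (h1 : IsAlgPt L (g 1)) (h0' : IsAlgPt L (g' 0)) (h1' : IsAlgPt L (g' 1))
    (hs : g' 0 = g 0 + v) (he : g' 1 = g 1 + v)
    (hne0 : ℘[L] (g 0) ≠ ℘[L] v) (hne1 : ℘[L] (g 1) ≠ ℘[L] v) :
    InSpan (Finsupp.single (⟨curve L, smooth L h₂ h₃, theta0 L, hasAlgCoeffs_theta0 L h₂ h₃,
        liftPath L g' hg' hΛ' h0' h1'⟩ : PeriodSymbol) (1 : ℂ) -
      Finsupp.single (⟨curve L, smooth L h₂ h₃, theta0 L, hasAlgCoeffs_theta0 L h₂ h₃,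
        liftPath L g hg hΛ h0 h1⟩ : PeriodSymbol) 1) := by
  classical
  obtain ⟨hp0, hm0⟩ := (weierstrassP_ne_iff L h0.1 hv.1).1 hne0
  obtain ⟨hp1, hm1⟩ := (weierstrassP_ne_iff L h1.1 hv.1).1 hne1
  -- re-route `g` around `Λ ∪ (v + Λ) ∪ (−v + Λ)`
  obtain ⟨k, hk, hk0, hk1, hkS⟩ := exists_path_avoiding_translates L ({0, v, -v} : Finset ℂ)
    (a := g 0) (b := g 1)
    (fun c hc => by
      simp only [Finset.mem_insert, Finset.mem_singleton] at hc
      rcases hc with rfl | rfl | rfl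
      · simpa using h0.1
      · exact hm0
      · simpa using hp0)
    (fun c hc => by
      simp only [Finset.mem_insert, Finset.mem_singleton] at hc
      rcases hc with rfl | rfl | rfl
      · simpa using h1.1
      · exact hm1
      · simpa using hp1)
  have hkΛ : ∀ t ∈ Icc (0 : ℝ) 1, k t ∉ L.lattice := fun t ht => by
    simpa using hkS t ht 0 (by simp)
  have hkne : ∀ t ∈ Icc (0 : ℝ) 1, ℘[L] (k t) ≠ ℘[L] v := fun t ht =>
    (weierstrassP_ne_iff L (hkΛ t ht) hv.1).2
      ⟨by simpa using hkS t ht (-v) (by simp), hkS t ht v (by simp)⟩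
  have hka : IsAlgPt L (k 0) := by rw [hk0]; exact h0
  have hkb : IsAlgPt L (k 1) := by rw [hk1]; exact h1
  have hk' : ContDiff ℝ 1 fun t => k t + v := hk.add contDiff_const
  have hkΛ' : ∀ t ∈ Icc (0 : ℝ) 1, k t + v ∉ L.lattice := fun t ht =>
    add_notMem_of_ne L v (hkΛ t ht) hv.1 (hkne t ht)
  have hka' : IsAlgPt L (k 0 + v) := IsAlgPt.add_of_ne L hka hv (hkne 0 ⟨le_rfl, zero_le_one⟩)
  have hkb' : IsAlgPt L (k 1 + v) := IsAlgPt.add_of_ne L hkb hv (hkne 1 ⟨zero_le_one, le_rfl⟩)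
  have rt := span_translate_theta0 L h₂ h₃ hv hk hkΛ hkne hka hkb hk' hkΛ' hka' hkb'
  have r := span_liftPath_sub_liftPath L h₂ h₃ hg hk hΛ hkΛ h0 h1 hka hkb hk0 hk1 (theta0 L)
    (hasAlgCoeffs_theta0 L h₂ h₃)
  have r' := span_liftPath_sub_liftPath L h₂ h₃ hg' hk' hΛ' hkΛ' h0' h1' hka' hkb'
    (by rw [hk0, hs]) (by rw [hk1, he]) (theta0 L) (hasAlgCoeffs_theta0 L h₂ h₃)
  obtain ⟨K, ρ, cf, hρ, hcf, hsum⟩ := span_add (span_sub r' r) rt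
  exact ⟨K, ρ, cf, hρ, hcf, by rw [← hsum]; abel⟩

/-- **Translation invariance for arbitrary lifts, `θ₁`** (up to the algebraic constant
`R(ψ_v(z₁)) − R(ψ_v(z₀))`, `R(ψ_v(z)) = −2(ζ(z + v) − ζ(z) − ζ(v))`). [cite: HuberWustholz2022, §13.1 (B) (p. 120), §18.1 (p. 160)] -/
theorem span_lift_translate_theta1 {v : ℂ} (hv : IsAlgPt L v) {g g' : ℝ → ℂ}
    (hg : ContDiff ℝ 1 g) (hg' : ContDiff ℝ 1 g')
    (hΛ : ∀ t ∈ Icc (0 : ℝ) 1, g t ∉ L.lattice) (hΛ' : ∀ t ∈ Icc (0 : ℝ) 1, g' t ∉ L.lattice)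
    (h0 : IsAlgPt L (g 0)) (h1 : IsAlgPt L (g 1)) (h0' : IsAlgPt L (g' 0)) (h1' : IsAlgPt L (g' 1))
    (hs : g' 0 = g 0 + v) (he : g' 1 = g 1 + v)
    (hne0 : ℘[L] (g 0) ≠ ℘[L] v) (hne1 : ℘[L] (g 1) ≠ ℘[L] v) :
    InSpan (Finsupp.single (⟨curve L, smooth L h₂ h₃, theta1 L, hasAlgCoeffs_theta1 L h₂ h₃,
        liftPath L g' hg' hΛ' h0' h1'⟩ : PeriodSymbol) (1 : ℂ) -
      Finsupp.single (⟨curve L, smooth L h₂ h₃, theta1 L, hasAlgCoeffs_theta1 L h₂ h₃,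
        liftPath L g hg hΛ h0 h1⟩ : PeriodSymbol) 1 -
      (eval (psiT L v (g 1)) (rPolyT L v) - eval (psiT L v (g 0)) (rPolyT L v)) •
        Finsupp.single PeriodSymbol.unit (1 : ℂ)) := by
  classical
  obtain ⟨hp0, hm0⟩ := (weierstrassP_ne_iff L h0.1 hv.1).1 hne0
  obtain ⟨hp1, hm1⟩ := (weierstrassP_ne_iff L h1.1 hv.1).1 hne1
  obtain ⟨k, hk, hk0, hk1, hkS⟩ := exists_path_avoiding_translates L ({0, v, -v} : Finset ℂ)
    (a := g 0) (b := g 1)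
    (fun c hc => by
      simp only [Finset.mem_insert, Finset.mem_singleton] at hc
      rcases hc with rfl | rfl | rfl
      · simpa using h0.1
      · exact hm0
      · simpa using hp0)
    (fun c hc => by
      simp only [Finset.mem_insert, Finset.mem_singleton] at hc
      rcases hc with rfl | rfl | rfl
      · simpa using h1.1
      · exact hm1
      · simpa using hp1)
  have hkΛ : ∀ t ∈ Icc (0 : ℝ) 1, k t ∉ L.lattice := fun t ht => by
    simpa using hkS t ht 0 (by simp)
  have hkne : ∀ t ∈ Icc (0 : ℝ) 1, ℘[L] (k t) ≠ ℘[L] v := fun t ht =>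
    (weierstrassP_ne_iff L (hkΛ t ht) hv.1).2
      ⟨by simpa using hkS t ht (-v) (by simp), hkS t ht v (by simp)⟩
  have hka : IsAlgPt L (k 0) := by rw [hk0]; exact h0
  have hkb : IsAlgPt L (k 1) := by rw [hk1]; exact h1
  have hk' : ContDiff ℝ 1 fun t => k t + v := hk.add contDiff_const
  have hkΛ' : ∀ t ∈ Icc (0 : ℝ) 1, k t + v ∉ L.lattice := fun t ht =>
    add_notMem_of_ne L v (hkΛ t ht) hv.1 (hkne t ht)
  have hka' : IsAlgPt L (k 0 + v) := IsAlgPt.add_of_ne L hka hv (hkne 0 ⟨le_rfl, zero_le_one⟩)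
  have hkb' : IsAlgPt L (k 1 + v) := IsAlgPt.add_of_ne L hkb hv (hkne 1 ⟨zero_le_one, le_rfl⟩)
  have rt := span_translate_theta1 L h₂ h₃ hv hk hkΛ hkne hka hkb hk' hkΛ' hka' hkb'
  rw [hk0, hk1] at rt
  have r := span_liftPath_sub_liftPath L h₂ h₃ hg hk hΛ hkΛ h0 h1 hka hkb hk0 hk1 (theta1 L)
    (hasAlgCoeffs_theta1 L h₂ h₃)
  have r' := span_liftPath_sub_liftPath L h₂ h₃ hg' hk' hΛ' hkΛ' h0' h1' hka' hkb'
    (by rw [hk0, hs]) (by rw [hk1, he]) (theta1 L) (hasAlgCoeffs_theta1 L h₂ h₃)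
  obtain ⟨K, ρ, cf, hρ, hcf, hsum⟩ := span_add (span_sub r' r) rt
  exact ⟨K, ρ, cf, hρ, hcf, by rw [← hsum]; abel⟩

end Calculus

end Ell

end CurvePeriods

end Literature.NumberTheory.Transcendental

end
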